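import Mathlib
import Summits.KontsevichZagierPeriods.Zeta5Search.Certificates.RecordRayGenericForms
import HarnessLib

/-! # Record ray, (N) for every `n ≥ 1` — E1. degrees of the generic forms at an affine point (S4-R1 item #10)

Step N-2b, first half: purely syntactic degree bookkeeping (closed bounds `nd_*` for `+ − * ^ neg`, numerals, casts, `X`,
and slots `x j` of an affine point `∀ j, natDegree (x j) ≤ 1`) and the degree bounds of fam-tele's generic forms
(`RecordRayGenericForms`) at an affine point `x : ℕ → R[X]` (`fe1G … raisePrG`), each as an explicit `nd_*` term (the terms
were synthesised by gen-2 g32's syntactic degree tactic and are written out here so that the file contains no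
metaprogramming).  Used by `RecordRayPgenDegree` (graded degrees of the step matrices and `natDegree (Pgen X i j) ≤ 355`).
No proposition is DEFINED here.

Provenance: gen-2 g32's kernel-checked scratch `AllN_G15.lean` (2026-08-22, rc 0 / 0 sorry, axioms propext ·
Classical.choice · Quot.sound), built on fam-tele g15's generic record-ray interface (`RecordRayGenericForms/Steps`,
`RecordRayMirror`, `RecordRayRaySteps`, `RecordRayChain`, all in the tree); data from gen-2 g31 (`P̂`, align) and fam-tele
g14 (`conn/PATH.md`).  Staged for the tree by gen-2 g33 (S4-R1 item #10); tactic-free rewrite of the degree proofs by P1 g15 (gate lint: no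
custom syntax / elaborators in tree sources).

HONEST FRAMING: systematic search; no irrationality claim unless certified; this is clause (N) of Brown–Zudilin's Theorem 1
(arXiv:2210.03391) for THEIR OWN record cell — the non-vanishing of their linear forms — and nothing about ζ(5) beyond that;
records UNMOVED. -/

namespace Summit.KontsevichZagierPeriods.Zeta5Search.RecordRay.Generic

open Polynomial

section DegreeTools
variable {R : Type*} [CommRing R]

/-- Degree bookkeeping: `natDegree (p + q) ≤ max m n`. -/
theorem nd_add {p q : R[X]} {m n : ℕ} (hp : p.natDegree ≤ m) (hq : q.natDegree ≤ n) :
    (p + q).natDegree ≤ max m n := (natDegree_add_le p q).trans (max_le_max hp hq)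
/-- Degree bookkeeping: `natDegree (p − q) ≤ max m n`. -/
theorem nd_sub {p q : R[X]} {m n : ℕ} (hp : p.natDegree ≤ m) (hq : q.natDegree ≤ n) :
    (p - q).natDegree ≤ max m n := natDegree_sub_le_of_le hp hq
/-- Degree bookkeeping: `natDegree (p * q) ≤ m + n`. -/
theorem nd_mul {p q : R[X]} {m n : ℕ} (hp : p.natDegree ≤ m) (hq : q.natDegree ≤ n) :
    (p * q).natDegree ≤ m + n := natDegree_mul_le_of_le hp hq
/-- Degree bookkeeping: `natDegree (−p) ≤ m`. -/
theorem nd_neg {p : R[X]} {m : ℕ} (hp : p.natDegree ≤ m) : (-p).natDegree ≤ m := natDegree_neg_le_of_le hp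
/-- Degree bookkeeping: `natDegree (p ^ k) ≤ k * m`. -/
theorem nd_pow {p : R[X]} {m : ℕ} (k : ℕ) (hp : p.natDegree ≤ m) : (p ^ k).natDegree ≤ k * m :=
  natDegree_pow_le_of_le k hp
/-- Degree bookkeeping: `natDegree X ≤ 1`. -/
theorem nd_X : (X : R[X]).natDegree ≤ 1 := natDegree_X_le
/-- Degree bookkeeping: `natDegree 1 ≤ 0`. -/
theorem nd_one : (1 : R[X]).natDegree ≤ 0 := natDegree_one.le
/-- Degree bookkeeping: `natDegree 0 ≤ 0`. -/
theorem nd_zero : (0 : R[X]).natDegree ≤ 0 := natDegree_zero.le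
/-- Degree bookkeeping: numerals have degree `0`. -/
theorem nd_ofNat (n : ℕ) [n.AtLeastTwo] : (OfNat.ofNat n : R[X]).natDegree ≤ 0 := (natDegree_ofNat n).le
/-- Degree bookkeeping: integer casts have degree `0`. -/
theorem nd_intCast (n : ℤ) : ((n : R[X])).natDegree ≤ 0 := (natDegree_intCast n).le
/-- Degree bookkeeping: natural-number casts have degree `0`. -/
theorem nd_natCast (n : ℕ) : ((n : R[X])).natDegree ≤ 0 := (natDegree_natCast n).le


/-! #### E.1 Affine points -/

/-- The generic ray point `rayPtG β X` is affine: every slot has degree `≤ 1` in `X`. -/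
theorem affPt_rayPtG (β : List ℤ) : ∀ j : ℕ, Polynomial.natDegree (rayPtG β (X : R[X]) j) ≤ 1 := by
  intro j; unfold rayPtG; exact le_trans (nd_add (nd_mul (nd_intCast (List.getD rayDir j 0)) nd_X) (nd_intCast
      (List.getD β j 0))) (by decide)

/-- Bumping a slot of an affine point gives an affine point. -/
theorem affPt_bumpG {x : ℕ → R[X]} (hx : ∀ j : ℕ, Polynomial.natDegree (x j) ≤ 1) (i : ℕ) :
    ∀ j : ℕ, Polynomial.natDegree (bumpG x i j) ≤ 1 := by
  intro j; unfold bumpG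
  rcases eq_or_ne j (i + 1) with h | h
  · subst h; rw [Function.update_self]; exact le_trans (nd_add (hx (i + 1)) nd_one) (by decide)
  · rw [Function.update_of_ne h]; exact hx j

/-! #### E.2 Degrees of the forms at an affine point -/
section Forms
variable {x : ℕ → R[X]} (hx : ∀ j : ℕ, Polynomial.natDegree (x j) ≤ 1)
include hx

/-- Degree bound for the generic form `fe1G` at an affine point (syntactic `nd_*` term). -/
theorem natDegree_fe1G_le : (fe1G x).natDegree ≤ 1 := by
  unfold fe1G; exact le_trans (nd_add (nd_add (nd_add (nd_add (nd_add (hx 1) (hx 2)) (hx 3)) (hx 4)) (hx 5)) (hx 6))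
      (by decide)

/-- Degree bound for the generic form `fe2G` at an affine point (syntactic `nd_*` term). -/
theorem natDegree_fe2G_le : (fe2G x).natDegree ≤ 2 := by
  unfold fe2G; exact le_trans (nd_add (nd_add (nd_add (nd_add (nd_add (nd_add (nd_add (nd_add (nd_add (nd_add
      (nd_add (nd_add (nd_add (nd_add (nd_mul (hx 1) (hx 2)) (nd_mul (hx 1) (hx 3))) (nd_mul (hx 1) (hx 4))) (nd_mul
      (hx 1) (hx 5))) (nd_mul (hx 1) (hx 6))) (nd_mul (hx 2) (hx 3))) (nd_mul (hx 2) (hx 4))) (nd_mul (hx 2)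
      (hx 5))) (nd_mul (hx 2) (hx 6))) (nd_mul (hx 3) (hx 4))) (nd_mul (hx 3) (hx 5))) (nd_mul (hx 3) (hx 6)))
      (nd_mul (hx 4) (hx 5))) (nd_mul (hx 4) (hx 6))) (nd_mul (hx 5) (hx 6))) (by decide)

/-- Degree bound for the generic form `fe3G` at an affine point (syntactic `nd_*` term). -/
theorem natDegree_fe3G_le : (fe3G x).natDegree ≤ 3 := by
  unfold fe3G; exact le_trans (nd_add (nd_add (nd_add (nd_add (nd_add (nd_add (nd_add (nd_add (nd_add (nd_add
      (nd_add (nd_add (nd_add (nd_add (nd_add (nd_add (nd_add (nd_add (nd_add (nd_mul (nd_mul (hx 1) (hx 2)) (hx 3))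
      (nd_mul (nd_mul (hx 1) (hx 2)) (hx 4))) (nd_mul (nd_mul (hx 1) (hx 2)) (hx 5))) (nd_mul (nd_mul (hx 1) (hx 2))
      (hx 6))) (nd_mul (nd_mul (hx 1) (hx 3)) (hx 4))) (nd_mul (nd_mul (hx 1) (hx 3)) (hx 5))) (nd_mul (nd_mul
      (hx 1) (hx 3)) (hx 6))) (nd_mul (nd_mul (hx 1) (hx 4)) (hx 5))) (nd_mul (nd_mul (hx 1) (hx 4)) (hx 6)))
      (nd_mul (nd_mul (hx 1) (hx 5)) (hx 6))) (nd_mul (nd_mul (hx 2) (hx 3)) (hx 4))) (nd_mul (nd_mul (hx 2) (hx 3))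
      (hx 5))) (nd_mul (nd_mul (hx 2) (hx 3)) (hx 6))) (nd_mul (nd_mul (hx 2) (hx 4)) (hx 5))) (nd_mul (nd_mul
      (hx 2) (hx 4)) (hx 6))) (nd_mul (nd_mul (hx 2) (hx 5)) (hx 6))) (nd_mul (nd_mul (hx 3) (hx 4)) (hx 5)))
      (nd_mul (nd_mul (hx 3) (hx 4)) (hx 6))) (nd_mul (nd_mul (hx 3) (hx 5)) (hx 6))) (nd_mul (nd_mul (hx 4) (hx 5))
      (hx 6))) (by decide)

/-- Degree bound for the generic form `fe4G` at an affine point (syntactic `nd_*` term). -/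
theorem natDegree_fe4G_le : (fe4G x).natDegree ≤ 4 := by
  unfold fe4G; exact le_trans (nd_add (nd_add (nd_add (nd_add (nd_add (nd_add (nd_add (nd_add (nd_add (nd_add
      (nd_add (nd_add (nd_add (nd_add (nd_mul (nd_mul (nd_mul (hx 1) (hx 2)) (hx 3)) (hx 4)) (nd_mul (nd_mul (nd_mul
      (hx 1) (hx 2)) (hx 3)) (hx 5))) (nd_mul (nd_mul (nd_mul (hx 1) (hx 2)) (hx 3)) (hx 6))) (nd_mul (nd_mul
      (nd_mul (hx 1) (hx 2)) (hx 4)) (hx 5))) (nd_mul (nd_mul (nd_mul (hx 1) (hx 2)) (hx 4)) (hx 6))) (nd_mul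
      (nd_mul (nd_mul (hx 1) (hx 2)) (hx 5)) (hx 6))) (nd_mul (nd_mul (nd_mul (hx 1) (hx 3)) (hx 4)) (hx 5)))
      (nd_mul (nd_mul (nd_mul (hx 1) (hx 3)) (hx 4)) (hx 6))) (nd_mul (nd_mul (nd_mul (hx 1) (hx 3)) (hx 5))
      (hx 6))) (nd_mul (nd_mul (nd_mul (hx 1) (hx 4)) (hx 5)) (hx 6))) (nd_mul (nd_mul (nd_mul (hx 2) (hx 3))
      (hx 4)) (hx 5))) (nd_mul (nd_mul (nd_mul (hx 2) (hx 3)) (hx 4)) (hx 6))) (nd_mul (nd_mul (nd_mul (hx 2)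
      (hx 3)) (hx 5)) (hx 6))) (nd_mul (nd_mul (nd_mul (hx 2) (hx 4)) (hx 5)) (hx 6))) (nd_mul (nd_mul (nd_mul
      (hx 3) (hx 4)) (hx 5)) (hx 6))) (by decide)

/-- Degree bound for the generic form `fe5G` at an affine point (syntactic `nd_*` term). -/
theorem natDegree_fe5G_le : (fe5G x).natDegree ≤ 5 := by
  unfold fe5G; exact le_trans (nd_add (nd_add (nd_add (nd_add (nd_add (nd_mul (nd_mul (nd_mul (nd_mul (hx 1) (hx 2))
      (hx 3)) (hx 4)) (hx 5)) (nd_mul (nd_mul (nd_mul (nd_mul (hx 1) (hx 2)) (hx 3)) (hx 4)) (hx 6))) (nd_mul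
      (nd_mul (nd_mul (nd_mul (hx 1) (hx 2)) (hx 3)) (hx 5)) (hx 6))) (nd_mul (nd_mul (nd_mul (nd_mul (hx 1) (hx 2))
      (hx 4)) (hx 5)) (hx 6))) (nd_mul (nd_mul (nd_mul (nd_mul (hx 1) (hx 3)) (hx 4)) (hx 5)) (hx 6))) (nd_mul
      (nd_mul (nd_mul (nd_mul (hx 2) (hx 3)) (hx 4)) (hx 5)) (hx 6))) (by decide)

/-- Degree bound for the generic form `fe6G` at an affine point (syntactic `nd_*` term). -/
theorem natDegree_fe6G_le : (fe6G x).natDegree ≤ 6 := by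
  unfold fe6G; exact le_trans (nd_mul (nd_mul (nd_mul (nd_mul (nd_mul (hx 1) (hx 2)) (hx 3)) (hx 4)) (hx 5)) (hx 6))
      (by decide)

/-- Degree bound for the generic form `topA3G` at an affine point (syntactic `nd_*` term). -/
theorem natDegree_topA3G_le : (topA3G x).natDegree ≤ 1 := by
  have h1 := natDegree_fe1G_le hx
  unfold topA3G; exact le_trans (nd_add (nd_add (nd_add (nd_mul (nd_neg (nd_ofNat 3)) (hx 0)) (hx 7)) h1) nd_one)
      (by decide)

/-- Degree bound for the generic form `topA2G` at an affine point (syntactic `nd_*` term). -/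
theorem natDegree_topA2G_le : (topA2G x).natDegree ≤ 3 := by
  have h1 := natDegree_fe1G_le hx
  have h2 := natDegree_fe2G_le hx
  have h3 := natDegree_fe3G_le hx
  unfold topA2G; exact le_trans (nd_add (nd_add (nd_add (nd_add (nd_sub (nd_sub (nd_sub (nd_add (nd_sub (nd_add
      (nd_add (nd_mul (nd_neg (nd_ofNat 4)) (nd_pow 3 (hx 0))) (nd_mul (nd_mul (nd_ofNat 3) (nd_pow 2 (hx 0)))
      (hx 7))) (nd_mul (nd_mul (nd_ofNat 3) (nd_pow 2 (hx 0))) h1)) (nd_mul (nd_mul (nd_mul (nd_ofNat 2) (hx 0))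
      (hx 7)) h1)) (nd_mul (nd_ofNat 6) (nd_pow 2 (hx 0)))) (nd_mul (nd_mul (nd_ofNat 3) (hx 0)) (hx 7))) (nd_mul
      (nd_mul (nd_ofNat 3) (hx 0)) h1)) (nd_mul (nd_mul (nd_ofNat 2) (hx 0)) h2)) (nd_mul (hx 7) h1)) (nd_mul
      (hx 7) h2)) h2) h3) (by decide)

/-- Degree bound for the generic form `topA1G` at an affine point (syntactic `nd_*` term). -/
theorem natDegree_topA1G_le : (topA1G x).natDegree ≤ 5 := by
  have h1 := natDegree_fe1G_le hx
  have h2 := natDegree_fe2G_le hx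
  have h3 := natDegree_fe3G_le hx
  have h4 := natDegree_fe4G_le hx
  have h5 := natDegree_fe5G_le hx
  unfold topA1G; exact le_trans (nd_add (nd_add (nd_add (nd_add (nd_sub (nd_sub (nd_sub (nd_sub (nd_add (nd_add
      (nd_add (nd_add (nd_sub (nd_sub (nd_sub (nd_add (nd_sub (nd_add (nd_add (nd_neg (nd_pow 5 (hx 0))) (nd_mul
      (nd_pow 4 (hx 0)) (hx 7))) (nd_mul (nd_pow 4 (hx 0)) h1)) (nd_mul (nd_mul (nd_pow 3 (hx 0)) (hx 7)) h1))
      (nd_mul (nd_ofNat 5) (nd_pow 4 (hx 0)))) (nd_mul (nd_mul (nd_ofNat 4) (nd_pow 3 (hx 0))) (hx 7))) (nd_mul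
      (nd_mul (nd_ofNat 4) (nd_pow 3 (hx 0))) h1)) (nd_mul (nd_pow 3 (hx 0)) h2)) (nd_mul (nd_mul (nd_mul
      (nd_ofNat 3) (nd_pow 2 (hx 0))) (hx 7)) h1)) (nd_mul (nd_mul (nd_pow 2 (hx 0)) (hx 7)) h2)) (nd_mul (nd_mul
      (nd_ofNat 3) (nd_pow 2 (hx 0))) h2)) (nd_mul (nd_pow 2 (hx 0)) h3)) (nd_mul (nd_mul (nd_mul (nd_ofNat 2)
      (hx 0)) (hx 7)) h2)) (nd_mul (nd_mul (hx 0) (hx 7)) h3)) (nd_mul (nd_mul (nd_ofNat 2) (hx 0)) h3)) (nd_mul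
      (hx 0) h4)) (nd_mul (hx 7) h3)) (nd_mul (hx 7) h4)) h4) h5) (by decide)

/-- Degree bound for the generic form `topA0G` at an affine point (syntactic `nd_*` term). -/
theorem natDegree_topA0G_le : (topA0G x).natDegree ≤ 7 := by
  have h1 := natDegree_fe1G_le hx
  have h2 := natDegree_fe2G_le hx
  have h3 := natDegree_fe3G_le hx
  have h4 := natDegree_fe4G_le hx
  have h5 := natDegree_fe5G_le hx
  have h6 := natDegree_fe6G_le hx
  unfold topA0G; exact le_trans (nd_add (nd_add (nd_add (nd_sub (nd_sub (nd_add (nd_add (nd_sub (nd_sub (nd_add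
      (nd_add (nd_sub (nd_sub (nd_pow 6 (hx 0)) (nd_mul (nd_pow 5 (hx 0)) (hx 7))) (nd_mul (nd_pow 5 (hx 0)) h1))
      (nd_mul (nd_mul (nd_pow 4 (hx 0)) (hx 7)) h1)) (nd_mul (nd_pow 4 (hx 0)) h2)) (nd_mul (nd_mul (nd_pow 3
      (hx 0)) (hx 7)) h2)) (nd_mul (nd_pow 3 (hx 0)) h3)) (nd_mul (nd_mul (nd_pow 2 (hx 0)) (hx 7)) h3)) (nd_mul
      (nd_pow 2 (hx 0)) h4)) (nd_mul (nd_mul (hx 0) (hx 7)) h4)) (nd_mul (hx 0) h5)) (nd_mul (hx 7) h5)) (nd_mul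
      (hx 7) h6)) h6) (by decide)

/-- Degree bound for the generic form `yNodeG x s` at an affine point, `deg s ≤ 1` (syntactic `nd_*` term). -/
theorem natDegree_yNodeG_le {s : R[X]} (hs : s.natDegree ≤ 1) : (yNodeG x s).natDegree ≤ 2 := by
  unfold yNodeG; exact le_trans (nd_mul (nd_neg hs) (nd_sub (hx 0) hs)) (by decide)

/-- Degree bound for the generic form `topGamma3G` at an affine point (syntactic `nd_*` term). -/
theorem natDegree_topGamma3G_le : (topGamma3G x).natDegree ≤ 1 := by
  have hA3 := natDegree_topA3G_le hx
  unfold topGamma3G; exact le_trans (hA3) (by decide)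

/-- Degree bound for the generic form `topGamma2G` at an affine point (syntactic `nd_*` term). -/
theorem natDegree_topGamma2G_le : (topGamma2G x).natDegree ≤ 3 := by
  have hA3 := natDegree_topA3G_le hx
  have hA2 := natDegree_topA2G_le hx
  have hA1 := natDegree_topA1G_le hx
  have hA0 := natDegree_topA0G_le hx
  have hy0 := natDegree_yNodeG_le hx (s := x 7) (le_trans (hx 7) (by decide))
  have hy1 := natDegree_yNodeG_le hx (s := x 7 + 1) (le_trans (nd_add (hx 7) nd_one) (by decide))
  have hy2 := natDegree_yNodeG_le hx (s := x 7 + 2) (le_trans (nd_add (hx 7) (nd_ofNat 2)) (by decide))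
  unfold topGamma2G; exact le_trans (nd_add hA2 (nd_mul hA3 (nd_add (nd_add hy0 hy1) hy2))) (by decide)

/-- Degree bound for the generic form `topGamma1G` at an affine point (syntactic `nd_*` term). -/
theorem natDegree_topGamma1G_le : (topGamma1G x).natDegree ≤ 5 := by
  have hA3 := natDegree_topA3G_le hx
  have hA2 := natDegree_topA2G_le hx
  have hA1 := natDegree_topA1G_le hx
  have hA0 := natDegree_topA0G_le hx
  have hy0 := natDegree_yNodeG_le hx (s := x 7) (le_trans (hx 7) (by decide))
  have hy1 := natDegree_yNodeG_le hx (s := x 7 + 1) (le_trans (nd_add (hx 7) nd_one) (by decide))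
  have hy2 := natDegree_yNodeG_le hx (s := x 7 + 2) (le_trans (nd_add (hx 7) (nd_ofNat 2)) (by decide))
  unfold topGamma1G; exact le_trans (nd_add (nd_add hA1 (nd_mul hA2 (nd_add hy0 hy1))) (nd_mul hA3 (nd_add (nd_add
      (nd_pow 2 hy0) (nd_mul hy0 hy1)) (nd_pow 2 hy1)))) (by decide)

/-- Degree bound for the generic form `topGamma0G` at an affine point (syntactic `nd_*` term). -/
theorem natDegree_topGamma0G_le : (topGamma0G x).natDegree ≤ 7 := by
  have hA3 := natDegree_topA3G_le hx
  have hA2 := natDegree_topA2G_le hx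
  have hA1 := natDegree_topA1G_le hx
  have hA0 := natDegree_topA0G_le hx
  have hy0 := natDegree_yNodeG_le hx (s := x 7) (le_trans (hx 7) (by decide))
  have hy1 := natDegree_yNodeG_le hx (s := x 7 + 1) (le_trans (nd_add (hx 7) nd_one) (by decide))
  have hy2 := natDegree_yNodeG_le hx (s := x 7 + 2) (le_trans (nd_add (hx 7) (nd_ofNat 2)) (by decide))
  unfold topGamma0G; exact le_trans (nd_add (nd_add (nd_add hA0 (nd_mul hA1 hy0)) (nd_mul hA2 (nd_pow 2 hy0)))
      (nd_mul hA3 (nd_pow 3 hy0))) (by decide)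

/-- Degree bound for the generic form `kapG` at an affine point (syntactic `nd_*` term). -/
theorem natDegree_kapG_le (i : ℕ) : (kapG x i).natDegree ≤ 2 := by
  unfold kapG; exact le_trans (nd_sub (nd_mul (hx (i + 1)) (nd_sub (hx 0) (hx (i + 1)))) (nd_mul (hx 7) (nd_sub
      (hx 0) (hx 7)))) (by decide)

/-- Degree bound for the generic form `dsLamG` at an affine point (syntactic `nd_*` term). -/
theorem natDegree_dsLamG_le (i : ℕ) : (dsLamG x i).natDegree ≤ 2 := by
  unfold dsLamG; exact le_trans (nd_mul (nd_add (hx (i + 1)) nd_one) (nd_add (nd_sub (hx 0) (hx (i + 1))) nd_one))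
      (by decide)

/-- Degree bound for the generic form `meetD0G` at an affine point (syntactic `nd_*` term). -/
theorem natDegree_meetD0G_le : (meetD0G x).natDegree ≤ 1 := by
  unfold meetD0G; exact le_trans (nd_sub (nd_sub (nd_sub (nd_sub (hx 0) nd_one) (hx 4)) (hx 5)) (hx 7)) (by decide)

/-- Degree bound for the generic form `meetAG` at an affine point (syntactic `nd_*` term). -/
theorem natDegree_meetAG_le : (meetAG x).natDegree ≤ 3 := by
  have hD := natDegree_meetD0G_le hx
  unfold meetAG; exact le_trans (nd_add (nd_mul (nd_mul hD (nd_add (hx 7) nd_one)) (nd_sub (nd_add (hx 0) nd_one)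
      (hx 7))) (nd_mul (nd_mul (nd_add (hx 4) nd_one) (nd_add (hx 5) nd_one)) (nd_add (hx 7) nd_one))) (by decide)

/-- Degree bound for the generic form `meetQG` at an affine point (syntactic `nd_*` term). -/
theorem natDegree_meetQG_le : (meetQG x).natDegree ≤ 1 := by
  unfold meetQG; exact le_trans (nd_neg (nd_sub (nd_sub (nd_sub (nd_sub (nd_add (nd_mul (nd_ofNat 2) (hx 0))
      (nd_ofNat 2)) (hx 1)) (hx 2)) (hx 3)) (hx 6))) (by decide)

/-- Degree bound for the generic form `raiseMG` at an affine point (syntactic `nd_*` term). -/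
theorem natDegree_raiseMG_le : (raiseMG x).natDegree ≤ 1 := by
  unfold raiseMG; exact le_trans (nd_add (hx 0) nd_one) (by decide)

/-- Degree bound for the generic form `uOfG` at an affine point (syntactic `nd_*` term). -/
theorem natDegree_uOfG_le (j : ℕ) : (uOfG x j).natDegree ≤ 1 := by
  unfold uOfG; exact le_trans (nd_sub (nd_add (hx 0) nd_one) (hx j)) (by decide)

/-- Degree bound for the generic form `raiseE1G` at an affine point (syntactic `nd_*` term). -/
theorem natDegree_raiseE1G_le : (raiseE1G x).natDegree ≤ 1 := by
  have hu1 := natDegree_uOfG_le hx 1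
  have hu2 := natDegree_uOfG_le hx 2
  have hu3 := natDegree_uOfG_le hx 3
  have hu6 := natDegree_uOfG_le hx 6
  unfold raiseE1G; exact le_trans (nd_add (nd_add (nd_add hu1 hu2) hu3) hu6) (by decide)

/-- Degree bound for the generic form `raiseE2G` at an affine point (syntactic `nd_*` term). -/
theorem natDegree_raiseE2G_le : (raiseE2G x).natDegree ≤ 2 := by
  have hu1 := natDegree_uOfG_le hx 1
  have hu2 := natDegree_uOfG_le hx 2
  have hu3 := natDegree_uOfG_le hx 3
  have hu6 := natDegree_uOfG_le hx 6
  unfold raiseE2G; exact le_trans (nd_add (nd_add (nd_add (nd_add (nd_add (nd_mul hu1 hu2) (nd_mul hu1 hu3))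
      (nd_mul hu1 hu6)) (nd_mul hu2 hu3)) (nd_mul hu2 hu6)) (nd_mul hu3 hu6)) (by decide)

/-- Degree bound for the generic form `raiseE3G` at an affine point (syntactic `nd_*` term). -/
theorem natDegree_raiseE3G_le : (raiseE3G x).natDegree ≤ 3 := by
  have hu1 := natDegree_uOfG_le hx 1
  have hu2 := natDegree_uOfG_le hx 2
  have hu3 := natDegree_uOfG_le hx 3
  have hu6 := natDegree_uOfG_le hx 6
  unfold raiseE3G; exact le_trans (nd_add (nd_add (nd_add (nd_mul (nd_mul hu1 hu2) hu3) (nd_mul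
      (nd_mul hu1 hu2) hu6)) (nd_mul (nd_mul hu1 hu3) hu6)) (nd_mul (nd_mul hu2 hu3) hu6)) (by decide)

omit hx in
/-- Degree bound for the generic form `qFormG` from bounds on its arguments (syntactic `nd_*` term). -/
theorem natDegree_qFormG_le {M e1 e2 e3 t : R[X]} (hM : M.natDegree ≤ 1) (h1 : e1.natDegree ≤ 1)
    (h2 : e2.natDegree ≤ 2)
    (h3 : e3.natDegree ≤ 3) (ht : t.natDegree ≤ 1) : (qFormG M e1 e2 e3 t).natDegree ≤ 3 := by
  unfold qFormG; exact le_trans (nd_add (nd_add (nd_mul (nd_sub h1 (nd_mul (nd_ofNat 2) hM)) (nd_pow 2 ht)) (nd_mul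
      (nd_mul (nd_sub h1 hM) (nd_sub h1 (nd_mul (nd_ofNat 2) hM))) ht)) (nd_sub (nd_sub (nd_mul
      (nd_sub h1 hM) h2) h3) (nd_mul hM (nd_pow 2 (nd_sub h1 hM))))) (by decide)

omit hx in
/-- Degree bound for the generic form `th2FormG` from bounds on its arguments (syntactic `nd_*` term). -/
theorem natDegree_th2FormG_le {M e1 e2 e3 w s1 s2 : R[X]} (hM : M.natDegree ≤ 1) (h1 : e1.natDegree ≤ 1)
    (h2 : e2.natDegree ≤ 2) (h3 : e3.natDegree ≤ 3) (hw : w.natDegree ≤ 1) (hs1 : s1.natDegree ≤ 1)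
        (hs2 : s2.natDegree ≤ 2) :
    (th2FormG M e1 e2 e3 w s1 s2).natDegree ≤ 4 := by
  unfold th2FormG; exact le_trans (nd_add (nd_add (nd_add (nd_add (nd_add (nd_add (nd_add (nd_add (nd_add (nd_sub
      (nd_add (nd_add (nd_sub (nd_add (nd_add (nd_sub (nd_add (nd_sub (nd_add (nd_sub (nd_add (nd_add (nd_sub
      (nd_sub (nd_mul (nd_ofNat 10) h1) (nd_mul (nd_ofNat 20) hM)) (nd_mul (nd_ofNat 5) (nd_pow 2 h1))) (nd_mul
      (nd_mul (nd_ofNat 9) hM) h1)) (nd_mul (nd_ofNat 2) (nd_pow 2 hM))) (nd_mul (nd_ofNat 2) h3)) (nd_mul (nd_mul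
      (nd_ofNat 2) h1) h2)) (nd_mul (nd_mul (nd_ofNat 2) hM) h2)) (nd_mul hM (nd_pow 2 h1))) (nd_mul (nd_mul
      (nd_ofNat 5) (nd_pow 2 hM)) h1)) (nd_mul (nd_ofNat 4) (nd_pow 3 hM))) (nd_mul hM h3)) (nd_mul
      (nd_mul hM h1) h2)) (nd_mul (nd_pow 2 hM) h2)) (nd_mul (nd_pow 2 hM) (nd_pow 2 h1))) (nd_mul (nd_mul
      (nd_ofNat 2) (nd_pow 3 hM)) h1)) (nd_pow 4 hM)) (nd_mul hs1 (nd_sub (nd_add (nd_sub (nd_sub (nd_add (nd_sub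
      (nd_sub (nd_add (nd_sub (nd_sub (nd_mul (nd_ofNat 5) h1) (nd_mul (nd_ofNat 10) hM)) (nd_mul (nd_ofNat 2)
      (nd_pow 2 h1))) (nd_mul (nd_mul (nd_ofNat 5) hM) h1)) (nd_mul (nd_ofNat 2) (nd_pow 2 hM))) h3) (nd_mul h1 h2))
      (nd_mul hM h2)) (nd_mul hM (nd_pow 2 h1))) (nd_mul (nd_mul (nd_ofNat 2) (nd_pow 2 hM)) h1)) (nd_pow 3 hM))))
      (nd_mul hs2 (nd_sub (nd_add (nd_sub (nd_sub (nd_mul (nd_ofNat 2) h1) (nd_mul (nd_ofNat 4) hM)) (nd_pow 2 h1))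
      (nd_mul (nd_mul (nd_ofNat 4) hM) h1)) (nd_mul (nd_ofNat 4) (nd_pow 2 hM))))) (nd_mul hw (nd_add (nd_sub
      (nd_add (nd_sub (nd_add (nd_sub (nd_add (nd_add (nd_sub (nd_sub (nd_mul (nd_ofNat 17) h1) (nd_mul
      (nd_ofNat 34) hM)) (nd_mul (nd_ofNat 6) (nd_pow 2 h1))) (nd_mul (nd_mul (nd_ofNat 11) hM) h1)) (nd_mul
      (nd_ofNat 2) (nd_pow 2 hM))) h3) (nd_mul h1 h2)) (nd_mul hM h2)) (nd_mul hM (nd_pow 2 h1))) (nd_mul (nd_mul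
      (nd_ofNat 4) (nd_pow 2 hM)) h1)) (nd_mul (nd_ofNat 3) (nd_pow 3 hM))))) (nd_mul (nd_mul hw hs1) (nd_add
      (nd_sub (nd_sub (nd_mul (nd_ofNat 6) h1) (nd_mul (nd_ofNat 12) hM)) (nd_pow 2 h1)) (nd_mul (nd_mul
      (nd_ofNat 2) hM) h1)))) (nd_mul (nd_mul hw hs2) (nd_sub h1 (nd_mul (nd_ofNat 2) hM)))) (nd_mul (nd_mul hw hw)
      (nd_add (nd_sub (nd_sub (nd_mul (nd_ofNat 10) h1) (nd_mul (nd_ofNat 20) hM)) (nd_mul (nd_ofNat 2)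
      (nd_pow 2 h1))) (nd_mul (nd_mul (nd_ofNat 4) hM) h1)))) (nd_mul (nd_mul (nd_mul hw hw) hs1) (nd_sub (nd_mul
      (nd_ofNat 2) h1) (nd_mul (nd_ofNat 4) hM)))) (nd_mul (nd_pow 3 hw) (nd_sub (nd_mul (nd_ofNat 2) h1) (nd_mul
      (nd_ofNat 4) hM)))) (by decide)

/-- Degree bound for the generic form `raiseQG` at an affine point (syntactic `nd_*` term). -/
theorem natDegree_raiseQG_le {t : R[X]} (ht : t.natDegree ≤ 1) : (raiseQG x t).natDegree ≤ 3 := by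
  unfold raiseQG
  exact natDegree_qFormG_le (natDegree_raiseMG_le hx) (natDegree_raiseE1G_le hx) (natDegree_raiseE2G_le hx)
    (natDegree_raiseE3G_le hx) ht

/-- Degree bound for the generic form `raiseTh1G` at an affine point (syntactic `nd_*` term). -/
theorem natDegree_raiseTh1G_le : (raiseTh1G x).natDegree ≤ 6 := by
  have hA := natDegree_meetAG_le hx
  have hq := natDegree_raiseQG_le hx (t := -(x 7 + 1)) (le_trans (nd_neg (nd_add (hx 7) nd_one)) (by decide))
  unfold raiseTh1G; exact le_trans (nd_mul hA hq) (by decide)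

/-- Degree bound for the generic form `raiseTh2G` at an affine point (syntactic `nd_*` term). -/
theorem natDegree_raiseTh2G_le : (raiseTh2G x).natDegree ≤ 4 := by
  unfold raiseTh2G
  exact natDegree_th2FormG_le (natDegree_raiseMG_le hx) (natDegree_raiseE1G_le hx) (natDegree_raiseE2G_le hx)
    (natDegree_raiseE3G_le hx) (hx 7) (le_trans (nd_add (hx 4) (hx 5)) (by decide)) (le_trans (nd_mul (hx 4) (hx 5))
        (by decide))

/-- Degree bound for the generic form `raiseDG` at an affine point (syntactic `nd_*` term). -/
theorem natDegree_raiseDG_le : (raiseDG x).natDegree ≤ 1 := by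
  unfold raiseDG; exact le_trans (nd_sub (nd_sub (nd_sub (nd_sub (nd_sub (nd_sub (nd_sub (nd_mul (nd_ofNat 3)
      (hx 0)) (hx 1)) (hx 2)) (hx 3)) (hx 4)) (hx 5)) (hx 6)) (hx 7)) (by decide)

/-- Degree bound for the generic form `raiseTh3G` at an affine point (syntactic `nd_*` term). -/
theorem natDegree_raiseTh3G_le : (raiseTh3G x).natDegree ≤ 2 := by
  have hD := natDegree_raiseDG_le hx
  have hQ := natDegree_meetQG_le hx
  unfold raiseTh3G; exact le_trans (nd_mul hD hQ) (by decide)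

/-- Degree bound for the generic form `raisePrG` at an affine point (syntactic `nd_*` term). -/
theorem natDegree_raisePrG_le : (raisePrG x).natDegree ≤ 6 := by
  unfold raisePrG; exact le_trans (nd_mul (nd_mul (nd_mul (nd_mul (nd_mul (nd_sub (nd_sub (nd_add (hx 0) nd_one)
      (hx 1)) (hx 2)) (nd_sub (nd_sub (nd_add (hx 0) nd_one) (hx 1)) (hx 3))) (nd_sub (nd_sub (nd_add (hx 0) nd_one)
      (hx 1)) (hx 6))) (nd_sub (nd_sub (nd_add (hx 0) nd_one) (hx 2)) (hx 3))) (nd_sub (nd_sub (nd_add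
      (hx 0) nd_one) (hx 2)) (hx 6))) (nd_sub (nd_sub (nd_add (hx 0) nd_one) (hx 3)) (hx 6))) (by decide)

end Forms

end DegreeTools

end Summit.KontsevichZagierPeriods.Zeta5Search.RecordRay.Generic
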